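import Literature.Topology.FourManifolds.CerfBirthDeath
import Literature.Analysis.Calculus.MvPolynomialFDeriv
import Mathlib.Algebra.MvPolynomial.Degrees
import HarnessLib

/-!
# Polynomial perturbation directions realise every 2-jet (the hypothesis of Thom's theorems in
# Cerf's Ch. II, for height functions of an immersed moving surface)

Topic `Literature/Topology/FourManifolds` (programme of the fact
`Literature.Topology.FourManifolds.cerf_pi0DiffDisc_relBoundary_three`, brick C1).  Cerf (LNM 53 (1968),
Ch. II §1) applies Thom's transversality theorems in the Fréchet space `Hom(V × I, ℝ)`; the
finite-dimensional shadow used by `CerfExcellentPaths.lean` asks that the finitely many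
perturbation directions `wᵢ` realise every 2-jet at every point — `CerfPath.D012 w z`
surjective — and jointly at pairs, triples and quadruples of distinct points.  For the height
of an embedded sphere the natural directions are the polynomials of the ambient `ℝ³` composed
with the embedding (Ch. II §3: `ℱ⁰, ℱ¹` are preimages under `ϖ ∘ j`, the `z`-coordinate of the
embedding; perturbing `z` by a polynomial `q` is perturbing the embedding by the shear
`(x, y, z) ↦ (x, y, z + q)`).  This file provides the family and proves the single-point half of
the spanning property:

* `CerfPath.MIdx d = Fin 3 → Fin (d + 1)` indexes the monomials `X^α` with exponents `≤ d`;
  `CerfPath.polyDir Φ α = X^α ∘ Φ` are the directions for a smooth chart reading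
  `Φ : ℝ × ℝ² → ℝ³` of the moving surface (`monoPoly`, `polyDir`);
* `exists_coeff_of_degreeOf_le` — every polynomial with `degreeOf ≤ d` in each variable is a
  combination of these monomials, so `toFun q ∘ Φ = perturb 0 (polyDir Φ) p` and its jets lie
  in the range of `D012` (`jets_mem_range_D012`);
* chain rules for the jets of `u ∘ Φ` (`d1_comp`, `d2_comp`);
* `surjective_D012_polyDir` — **at a point where `Φ(λ, ·)` is an immersion, the monomials of
  degree `≤ 2` realise every 2-jet** (`d ≥ 2`): affine functions adjusted on the two independent
  vectors `∂ₓΦ, ∂_yΦ` give the 1-jet, quadratic forms the second partials.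

Everything is proved; the definitions are the index type, the monomials and the directions.
The multi-point spanning (pairs, triples, quadruples at distinct image points) is in the sequel
`CerfPolynomialDirectionsMulti.lean`.

## References

* J. Cerf, *Sur les difféomorphismes de la sphère de dimension trois (Γ₄ = 0)*, LNM 53 (1968),
  Ch. II §1 (Thom's theorems), §3 (the projection `ϖ`). [CerfDiffeoSphere1968]
* R. Thom, *Un lemme sur les applications différentiables*, Bol. Soc. Mat. Mexicana (1956).
-/

noncomputable section

open Set Function Filter Module
open scoped ContDiff Topology BigOperators

namespace Literature.Topology.FourManifolds

namespace CerfPath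

open Literature.Analysis.Calculus Literature.Analysis.Calculus.MvPoly
  Literature.Analysis.Calculus.ParametricTransversality

/-- Local notation: the model plane. -/
local notation "𝔼²" => EuclideanSpace ℝ (Fin 2)
/-- Local notation: the ambient space. -/
local notation "𝔼³" => EuclideanSpace ℝ (Fin 3)

/-! ### The monomial directions -/

/-- Indices of the monomials of `ℝ[X₀, X₁, X₂]` with all exponents `≤ d`. [folklore] -/
abbrev MIdx (d : ℕ) := Fin 3 → Fin (d + 1)

variable {d : ℕ}

/-- The exponent vector of an index. [folklore] -/
def expo (α : MIdx d) : Fin 3 →₀ ℕ := Finsupp.equivFunOnFinite.symm fun i => (α i : ℕ)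

/-- `expo α i = α i`. [folklore] -/
@[simp] theorem expo_apply (α : MIdx d) (i : Fin 3) : expo α i = (α i : ℕ) := by
  simp [expo]

/-- `expo` is injective. [folklore] -/
theorem expo_injective : Injective (expo (d := d)) := by
  intro α β h
  funext i
  apply Fin.ext
  have := congrArg (fun e : Fin 3 →₀ ℕ => e i) h
  simpa using this

/-- The monomial `X^α`. [folklore] -/
def monoPoly (α : MIdx d) : MvPolynomial (Fin 3) ℝ := MvPolynomial.monomial (expo α) 1

/-- The value of the monomial function: `∏ Xᵢ ^ αᵢ`. [folklore] -/
theorem toFun_monoPoly (α : MIdx d) (X : 𝔼³) : toFun (monoPoly α) X = ∏ i, X i ^ (α i : ℕ) := by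
  rw [toFun_apply, monoPoly, MvPolynomial.eval_monomial, one_mul,
    Finsupp.prod_fintype _ _ (fun i => by simp)]
  simp

/-- **The perturbation directions**: monomials of the ambient coordinates composed with the
chart reading `Φ : ℝ × ℝ² → ℝ³` of the moving surface. [cite: CerfDiffeoSphere1968, Ch. II §3] -/
def polyDir (Φ : ℝ × 𝔼² → 𝔼³) (α : MIdx d) : ℝ × 𝔼² → ℝ := fun z => toFun (monoPoly α) (Φ z)

/-- Unfolding of `polyDir`. [folklore] -/
theorem polyDir_apply (Φ : ℝ × 𝔼² → 𝔼³) (α : MIdx d) (z : ℝ × 𝔼²) :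
    polyDir Φ α z = toFun (monoPoly α) (Φ z) := rfl

/-- The directions are smooth when the chart reading is. [folklore] -/
theorem contDiff_polyDir {Φ : ℝ × 𝔼² → 𝔼³} (hΦ : ContDiff ℝ ∞ Φ) (α : MIdx d) :
    ContDiff ℝ ∞ (polyDir Φ α) :=
  (contDiff_toFun (monoPoly α)).comp hΦ

/-! ### Every polynomial of bounded degree is a combination of the monomials -/

/-- **Realisability**: a polynomial with `degreeOf i q ≤ d` for every variable is the
combination `∑ (coeff q (expo α)) • X^α` of the bounded monomials. [folklore] -/
theorem toFun_eq_sum_coeff {q : MvPolynomial (Fin 3) ℝ} (hq : ∀ i, q.degreeOf i ≤ d) (X : 𝔼³) :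
    toFun q X = ∑ α : MIdx d, q.coeff (expo α) * toFun (monoPoly α) X := by
  classical
  rw [toFun_apply, MvPolynomial.eval_eq']
  -- reindex the sum over the support by the bounded indices
  have hsupp : ∀ β ∈ q.support, ∃ α : MIdx d, expo α = β := by
    intro β hβ
    refine ⟨fun i => ⟨β i, Nat.lt_succ_of_le ((MvPolynomial.monomial_le_degreeOf i hβ).trans (hq i))⟩, ?_⟩
    ext i; simp
  symm
  calc ∑ α : MIdx d, q.coeff (expo α) * toFun (monoPoly α) X
      = ∑ β ∈ (Finset.univ : Finset (MIdx d)).image expo,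
          q.coeff β * ∏ i, X i ^ β i := by
        rw [Finset.sum_image (fun α _ β _ h => expo_injective h)]
        refine Finset.sum_congr rfl fun α _ => ?_
        rw [toFun_monoPoly]
        simp
    _ = ∑ β ∈ q.support, q.coeff β * ∏ i, X i ^ β i := by
        refine (Finset.sum_subset (fun β hβ => ?_) (fun β _ hβ => ?_)).symm
        · obtain ⟨α, rfl⟩ := hsupp β hβ
          exact Finset.mem_image_of_mem _ (Finset.mem_univ α)
        · rw [MvPolynomial.notMem_support_iff.1 hβ, zero_mul]
    _ = ∑ β ∈ q.support, q.coeff β * ∏ i, (fun i => X i) i ^ β i := rfl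

/-- A polynomial of bounded degree composed with `Φ` is a member of the perturbation family
`perturb 0 (polyDir Φ)`. [folklore] -/
theorem exists_coeff_of_degreeOf_le {q : MvPolynomial (Fin 3) ℝ} (hq : ∀ i, q.degreeOf i ≤ d)
    (Φ : ℝ × 𝔼² → 𝔼³) :
    ∃ p : MIdx d → ℝ, (fun z => toFun q (Φ z)) = perturb 0 (polyDir Φ) p := by
  refine ⟨fun α => q.coeff (expo α), ?_⟩
  funext z
  rw [perturb_apply, Pi.zero_apply, zero_add, toFun_eq_sum_coeff hq]
  rfl

/-! ### The jets of a member of the family are in the range of `D012` -/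

section Range

variable {Φ : ℝ × 𝔼² → 𝔼³}

/-- The value of `perturb 0 w p` is `D0 w z p`. [folklore] -/
theorem perturb_zero_eq_D0 {ι : Type*} [Fintype ι] (w : ι → ℝ × 𝔼² → ℝ) (p : ι → ℝ)
    (z : ℝ × 𝔼²) : perturb 0 w p z = D0 w z p := by
  rw [perturb_apply, D0_apply]; simp

/-- `(p, q)` of `perturb 0 w p` is `D1 w z p`. [folklore] -/
theorem d1_perturb_zero_eq_D1 {ι : Type*} [Fintype ι] {w : ι → ℝ × 𝔼² → ℝ}
    (hw : ∀ i, Differentiable ℝ (w i)) (p : ι → ℝ) (z : ℝ × 𝔼²) :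
    d1 (perturb 0 w p) z = D1 w z p := by
  funext j
  have h0 : Differentiable ℝ (0 : ℝ × 𝔼² → ℝ) := differentiable_const (0 : ℝ)
  rw [d1_perturb h0 hw, D1_apply]
  simp [d1, Finset.sum_apply, smul_eq_mul]

/-- `(r, s, t)` of `perturb 0 w p` is `D2 w z p`. [folklore] -/
theorem jet2_perturb_zero_eq_D2 {ι : Type*} [Fintype ι] {w : ι → ℝ × 𝔼² → ℝ}
    (hw : ∀ i, ContDiff ℝ 2 (w i)) (p : ι → ℝ) (z : ℝ × 𝔼²) :
    jet2 (perturb 0 w p) z = D2 w z p := by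
  have h0 : ContDiff ℝ 2 (0 : ℝ × 𝔼² → ℝ) := contDiff_const (c := (0 : ℝ))
  rw [jet2_perturb h0 hw, D2_apply]
  have : jet2 (0 : ℝ × 𝔼² → ℝ) z = 0 := by
    funext m; fin_cases m <;> simp [jet2, d2]
  rw [this, zero_add]

/-- **The jets of any polynomial of bounded degree composed with `Φ` lie in the range of the
jet map of the monomial family.** [folklore] -/
theorem jets_mem_range_D012 (hΦ : ContDiff ℝ ∞ Φ) {q : MvPolynomial (Fin 3) ℝ}
    (hq : ∀ i, q.degreeOf i ≤ d) (z : ℝ × 𝔼²) :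
    ((toFun q (Φ z), d1 (fun z => toFun q (Φ z)) z, jet2 (fun z => toFun q (Φ z)) z) :
        ℝ × (Fin 2 → ℝ) × (Fin 3 → ℝ)) ∈ Set.range (D012 (polyDir (d := d) Φ) z) := by
  obtain ⟨p, hp⟩ := exists_coeff_of_degreeOf_le hq Φ
  refine ⟨p, ?_⟩
  have hw1 : ∀ α : MIdx d, Differentiable ℝ (polyDir Φ α) := fun α =>
    (contDiff_polyDir hΦ α).differentiable (by simp)
  have hw2 : ∀ α : MIdx d, ContDiff ℝ 2 (polyDir Φ α) := fun α =>
    (contDiff_polyDir hΦ α).of_le two_le_infty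
  have hv : toFun q (Φ z) = perturb 0 (polyDir Φ) p z := congrFun hp z
  rw [D012_apply, hp, hv, perturb_zero_eq_D0, d1_perturb_zero_eq_D1 hw1, jet2_perturb_zero_eq_D2 hw2]

/-- The same for two chart readings at once (the same polynomial, two points). [folklore] -/
theorem jets_mem_range_D012_pair {Φa Φb : ℝ × 𝔼² → 𝔼³} (hΦa : ContDiff ℝ ∞ Φa)
    (hΦb : ContDiff ℝ ∞ Φb) {q : MvPolynomial (Fin 3) ℝ} (hq : ∀ i, q.degreeOf i ≤ d)
    (za zb : ℝ × 𝔼²) :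
    (((toFun q (Φa za), d1 (fun z => toFun q (Φa z)) za, jet2 (fun z => toFun q (Φa z)) za),
      (toFun q (Φb zb), d1 (fun z => toFun q (Φb z)) zb, jet2 (fun z => toFun q (Φb z)) zb)) :
        (ℝ × (Fin 2 → ℝ) × (Fin 3 → ℝ)) × (ℝ × (Fin 2 → ℝ) × (Fin 3 → ℝ))) ∈
      Set.range ((D012 (polyDir (d := d) Φa) za).prod (D012 (polyDir (d := d) Φb) zb)) := by
  refine ⟨fun α : MIdx d => q.coeff (expo α), ?_⟩
  -- both realisations use the same coefficients `coeff q ∘ expo`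
  have ha : (fun z => toFun q (Φa z)) =
      perturb 0 (polyDir (d := d) Φa) fun α : MIdx d => q.coeff (expo α) := by
    funext z; rw [perturb_apply, Pi.zero_apply, zero_add, toFun_eq_sum_coeff hq]; rfl
  have hb : (fun z => toFun q (Φb z)) =
      perturb 0 (polyDir (d := d) Φb) fun α : MIdx d => q.coeff (expo α) := by
    funext z; rw [perturb_apply, Pi.zero_apply, zero_add, toFun_eq_sum_coeff hq]; rfl
  have hva : toFun q (Φa za) = perturb 0 (polyDir (d := d) Φa) (fun α : MIdx d => q.coeff (expo α)) za :=
    congrFun ha za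
  have hvb : toFun q (Φb zb) = perturb 0 (polyDir (d := d) Φb) (fun α : MIdx d => q.coeff (expo α)) zb :=
    congrFun hb zb
  have hw1a : ∀ α : MIdx d, Differentiable ℝ (polyDir Φa α) := fun α =>
    (contDiff_polyDir hΦa α).differentiable (by simp)
  have hw2a : ∀ α : MIdx d, ContDiff ℝ 2 (polyDir Φa α) := fun α =>
    (contDiff_polyDir hΦa α).of_le two_le_infty
  have hw1b : ∀ α : MIdx d, Differentiable ℝ (polyDir Φb α) := fun α =>
    (contDiff_polyDir hΦb α).differentiable (by simp)
  have hw2b : ∀ α : MIdx d, ContDiff ℝ 2 (polyDir Φb α) := fun α =>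
    (contDiff_polyDir hΦb α).of_le two_le_infty
  rw [ContinuousLinearMap.prod_apply, D012_apply, D012_apply, ha, hb, hva, hvb, perturb_zero_eq_D0,
    perturb_zero_eq_D0, d1_perturb_zero_eq_D1 hw1a, d1_perturb_zero_eq_D1 hw1b,
    jet2_perturb_zero_eq_D2 hw2a, jet2_perturb_zero_eq_D2 hw2b]

end Range

/-! ### Chain rules: the jets of `u ∘ Φ` -/

section Chain

variable {Φ : ℝ × 𝔼² → 𝔼³} {u : 𝔼³ → ℝ}

/-- **First partials of a composition**: `∂ᵢ(u ∘ Φ)(z) = Du(Φ z)(∂ᵢΦ z)`. [folklore] -/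
theorem d1_comp (hu : Differentiable ℝ u) (hΦ : Differentiable ℝ Φ) (z : ℝ × 𝔼²) (i : Fin 2) :
    d1 (fun z => u (Φ z)) z i = fderiv ℝ u (Φ z) (fderiv ℝ Φ z (dir i)) := by
  rw [d1, show (fun z => u (Φ z)) = u ∘ Φ from rfl, fderiv_comp z (hu _) (hΦ z)]
  rfl

/-- The derivative of the composition as a function (everywhere). [folklore] -/
theorem fderiv_comp_eq (hu : Differentiable ℝ u) (hΦ : Differentiable ℝ Φ) :
    fderiv ℝ (fun z => u (Φ z)) = fun z => (fderiv ℝ u (Φ z)).comp (fderiv ℝ Φ z) := by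
  funext z
  rw [show (fun z => u (Φ z)) = u ∘ Φ from rfl, fderiv_comp z (hu _) (hΦ z)]

/-- **Second partials of a composition**:
`∂ᵢ∂ⱼ(u ∘ Φ)(z) = D²u(Φ z)(∂ᵢΦ, ∂ⱼΦ) + Du(Φ z)(∂ᵢ∂ⱼΦ)`. [folklore] -/
theorem d2_comp (hu : ContDiff ℝ 2 u) (hΦ : ContDiff ℝ 2 Φ) (z : ℝ × 𝔼²) (i j : Fin 2) :
    d2 (fun z => u (Φ z)) z i j =
      fderiv ℝ (fderiv ℝ u) (Φ z) (fderiv ℝ Φ z (dir i)) (fderiv ℝ Φ z (dir j)) +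
        fderiv ℝ u (Φ z) (fderiv ℝ (fderiv ℝ Φ) z (dir i) (dir j)) := by
  have hu1 : Differentiable ℝ u := hu.differentiable two_ne_zero
  have hΦ1 : Differentiable ℝ Φ := hΦ.differentiable two_ne_zero
  have hu2 : Differentiable ℝ (fderiv ℝ u) :=
    (hu.fderiv_right (m := 1) (by norm_num)).differentiable one_ne_zero
  have hΦ2 : Differentiable ℝ (fderiv ℝ Φ) :=
    (hΦ.fderiv_right (m := 1) (by norm_num)).differentiable one_ne_zero
  rw [d2, fderiv_comp_eq hu1 hΦ1]
  have hc : HasFDerivAt (fun z => fderiv ℝ u (Φ z))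
      ((fderiv ℝ (fderiv ℝ u) (Φ z)).comp (fderiv ℝ Φ z)) z := by
    have h := ((hu2 (Φ z)).hasFDerivAt).comp z ((hΦ1 z).hasFDerivAt)
    exact h
  have hd : HasFDerivAt (fun z => fderiv ℝ Φ z) (fderiv ℝ (fderiv ℝ Φ) z) z :=
    (hΦ2 z).hasFDerivAt
  rw [(hc.clm_comp hd).fderiv]
  simp [ContinuousLinearMap.compL_apply, ContinuousLinearMap.flip_apply,
    ContinuousLinearMap.comp_apply]
  ring

end Chain

/-! ### Leibniz rules for the jets of a product -/

section Leibniz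

variable {a b : ℝ × 𝔼² → ℝ}

/-- The derivative of a product, as a function (everywhere). [folklore] -/
theorem fderiv_mul_eq (ha : Differentiable ℝ a) (hb : Differentiable ℝ b) :
    fderiv ℝ (fun z => a z * b z) = fun z => a z • fderiv ℝ b z + b z • fderiv ℝ a z := by
  funext z; exact fderiv_fun_mul (ha z) (hb z)

/-- **First partials of a product**: `∂ᵢ(ab) = a ∂ᵢb + b ∂ᵢa`. [folklore] -/
theorem d1_mul (ha : Differentiable ℝ a) (hb : Differentiable ℝ b) (z : ℝ × 𝔼²) (i : Fin 2) :
    d1 (fun z => a z * b z) z i = a z * d1 b z i + b z * d1 a z i := by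
  simp [d1, fderiv_mul_eq ha hb, smul_eq_mul]

/-- **Second partials of a product**:
`∂ᵢ∂ⱼ(ab) = a ∂ᵢ∂ⱼb + b ∂ᵢ∂ⱼa + ∂ᵢa ∂ⱼb + ∂ⱼa ∂ᵢb`. [folklore] -/
theorem d2_mul (ha : ContDiff ℝ 2 a) (hb : ContDiff ℝ 2 b) (z : ℝ × 𝔼²) (i j : Fin 2) :
    d2 (fun z => a z * b z) z i j =
      a z * d2 b z i j + b z * d2 a z i j + d1 a z i * d1 b z j + d1 a z j * d1 b z i := by
  have ha1 : Differentiable ℝ a := ha.differentiable two_ne_zero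
  have hb1 : Differentiable ℝ b := hb.differentiable two_ne_zero
  have ha2 : Differentiable ℝ (fderiv ℝ a) :=
    (ha.fderiv_right (m := 1) (by norm_num)).differentiable one_ne_zero
  have hb2 : Differentiable ℝ (fderiv ℝ b) :=
    (hb.fderiv_right (m := 1) (by norm_num)).differentiable one_ne_zero
  rw [d2, fderiv_mul_eq ha1 hb1]
  have h1 : HasFDerivAt (fun z => a z • fderiv ℝ b z)
      (a z • fderiv ℝ (fderiv ℝ b) z + (fderiv ℝ a z).smulRight (fderiv ℝ b z)) z :=
    ((ha1 z).hasFDerivAt).smul ((hb2 z).hasFDerivAt)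
  have h2 : HasFDerivAt (fun z => b z • fderiv ℝ a z)
      (b z • fderiv ℝ (fderiv ℝ a) z + (fderiv ℝ b z).smulRight (fderiv ℝ a z)) z :=
    ((hb1 z).hasFDerivAt).smul ((ha2 z).hasFDerivAt)
  rw [(h1.fun_add h2).fderiv]
  simp [d1, d2, ContinuousLinearMap.smulRight_apply, smul_eq_mul]
  ring

end Leibniz

/-! ### Affine functionals composed with the chart reading -/

section Affine

variable {Φ : ℝ × 𝔼² → 𝔼³}

/-- The composed affine function `z ↦ λ(Φ z - P)`. Its value where `Φ z = P` is `0`.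
[folklore] -/
theorem affine_comp_apply_eq_zero (lam : 𝔼³ →L[ℝ] ℝ) {P : 𝔼³} {z : ℝ × 𝔼²} (hP : Φ z = P) :
    lam (Φ z - P) = 0 := by rw [hP, sub_self, map_zero]

/-- First partials of the composed affine function: `∂ᵢ(λ(Φ - P)) = λ(∂ᵢΦ)`. [folklore] -/
theorem d1_affine_comp (lam : 𝔼³ →L[ℝ] ℝ) (P : 𝔼³) (hΦ : Differentiable ℝ Φ) (z : ℝ × 𝔼²)
    (i : Fin 2) : d1 (fun z => lam (Φ z - P)) z i = lam (fderiv ℝ Φ z (dir i)) := by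
  have hu : Differentiable ℝ fun X : 𝔼³ => lam (X - P) :=
    lam.differentiable.comp (differentiable_id.sub (differentiable_const P))
  rw [d1_comp (u := fun X => lam (X - P)) hu hΦ]
  have hd : HasFDerivAt (fun X : 𝔼³ => lam (X - P)) lam (Φ z) := by
    have h := lam.hasFDerivAt.comp (Φ z) ((hasFDerivAt_id (Φ z)).sub_const P)
    rw [ContinuousLinearMap.comp_id] at h
    exact h
  rw [hd.fderiv]

/-- The composed affine function is smooth. [folklore] -/
theorem contDiff_affine_comp (lam : 𝔼³ →L[ℝ] ℝ) (P : 𝔼³) (hΦ : ContDiff ℝ ∞ Φ) :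
    ContDiff ℝ ∞ fun z => lam (Φ z - P) :=
  lam.contDiff.comp (hΦ.sub contDiff_const)

end Affine

/-! ### Dual functionals to two independent vectors -/

section Dual

/-- **Dual functionals**: for two linearly independent vectors `u₀, u₁` of `ℝ³` there are
continuous linear functionals `λ₀, λ₁` with `λₖ(uᵢ) = δₖᵢ` (left inverse of the injective map
`c ↦ c₀ u₀ + c₁ u₁`). [folklore] -/
theorem exists_dual_functionals {u : Fin 2 → 𝔼³} (hu : LinearIndependent ℝ u) :
    ∃ lam : Fin 2 → (𝔼³ →L[ℝ] ℝ), ∀ k i, lam k (u i) = if k = i then 1 else 0 := by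
  classical
  -- the map `c ↦ ∑ cᵢ uᵢ`
  set T : (Fin 2 → ℝ) →ₗ[ℝ] 𝔼³ := ∑ i, (LinearMap.proj i : (Fin 2 → ℝ) →ₗ[ℝ] ℝ).smulRight (u i)
    with hT
  have hT_apply : ∀ c : Fin 2 → ℝ, T c = ∑ i, c i • u i := fun c => by
    simp [hT, LinearMap.smulRight_apply]
  have hTinj : LinearMap.ker T = ⊥ := by
    rw [LinearMap.ker_eq_bot']
    intro c hc
    rw [hT_apply] at hc
    funext i
    exact (Fintype.linearIndependent_iff.1 hu c hc) i
  obtain ⟨g, hg⟩ := LinearMap.exists_leftInverse_of_injective T hTinj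
  refine ⟨fun k => LinearMap.toContinuousLinearMap ((LinearMap.proj k : (Fin 2 → ℝ) →ₗ[ℝ] ℝ) ∘ₗ g),
    fun k i => ?_⟩
  have hTi : T (Pi.single i 1) = u i := by
    rw [hT_apply]; simp [Pi.single_apply, Finset.sum_ite_eq']
  have hgi : g (u i) = Pi.single i 1 := by
    rw [← hTi]
    have := congrArg (fun L : (Fin 2 → ℝ) →ₗ[ℝ] (Fin 2 → ℝ) => L (Pi.single i 1)) hg
    simpa using this
  simp [hgi, Pi.single_apply]

end Dual

/-! ### Single-point spanning: the monomials of degree `≤ 2` realise every 2-jet -/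

section SinglePoint

variable {Φ : ℝ × 𝔼² → 𝔼³}

/-- A continuous linear functional on `ℝ³` through the standard basis. [folklore] -/
theorem clm_apply_eq_sum_three (lam : 𝔼³ →L[ℝ] ℝ) (Y : 𝔼³) :
    lam Y = ∑ m, Y m * lam (EuclideanSpace.single m 1) := by
  have h : Y = ∑ m, Y m • EuclideanSpace.single m (1 : ℝ) := by
    simpa using ((EuclideanSpace.basisFun (Fin 3) ℝ).sum_repr Y).symm
  conv_lhs => rw [h]
  simp [map_sum, map_smul, smul_eq_mul]

/-- The polynomial of the affine functional `X ↦ λ(X - P)`. [folklore] -/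
theorem exists_poly_affine (lam : 𝔼³ →L[ℝ] ℝ) (P : 𝔼³) :
    ∃ Λ : MvPolynomial (Fin 3) ℝ, (∀ i, Λ.degreeOf i ≤ 1) ∧ ∀ X : 𝔼³, toFun Λ X = lam (X - P) := by
  classical
  refine ⟨∑ m, MvPolynomial.C (lam (EuclideanSpace.single m 1)) *
      (MvPolynomial.X m - MvPolynomial.C (P m)), fun i => ?_, fun X => ?_⟩
  · refine (MvPolynomial.degreeOf_sum_le i _ _).trans (Finset.sup_le fun m _ => ?_)
    refine (MvPolynomial.degreeOf_mul_le i _ _).trans ?_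
    rw [MvPolynomial.degreeOf_C, zero_add]
    refine (MvPolynomial.degreeOf_sub_le i _ _).trans (max_le ?_ ?_)
    · rw [MvPolynomial.degreeOf_X]; split_ifs <;> simp
    · rw [MvPolynomial.degreeOf_C]; exact Nat.zero_le _
  · rw [clm_apply_eq_sum_three lam (X - P), toFun_sum]
    refine Finset.sum_congr rfl fun m _ => ?_
    simp [toFun_apply, mul_comm]

/-- **Single-point spanning (the hypothesis of Thom's local transversality theorem in finite
dimensions).**  If the chart reading `Φ` of the moving surface is smooth and its slice is an
immersion at `z` (`∂ₓΦ(z), ∂_yΦ(z)` linearly independent), then the monomials of degree `≤ 2`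
(any `d ≥ 2`) composed with `Φ` realise every 2-jet at `z`: `D012 (polyDir Φ) z` is onto.
Constants give the value, affine functionals dual to `∂ₓΦ, ∂_yΦ` the first partials, and their
products the second partials. [cite: CerfDiffeoSphere1968, Ch. II §1, théorème de transversalité local] -/
theorem surjective_D012_polyDir (hd : 2 ≤ d) (hΦ : ContDiff ℝ ∞ Φ) {z : ℝ × 𝔼²}
    (himm : LinearIndependent ℝ (fun i : Fin 2 => fderiv ℝ Φ z (dir i))) :
    Surjective (D012 (polyDir (d := d) Φ) z) := by
  classical
  have hΦ1 : Differentiable ℝ Φ := hΦ.differentiable (by simp)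
  obtain ⟨lam, hlam⟩ := exists_dual_functionals himm
  set P : 𝔼³ := Φ z with hP
  -- the range as a submodule
  set R : Submodule ℝ (ℝ × (Fin 2 → ℝ) × (Fin 3 → ℝ)) :=
    LinearMap.range ((D012 (polyDir (d := d) Φ) z : (MIdx d → ℝ) →L[ℝ] _) :
      (MIdx d → ℝ) →ₗ[ℝ] ℝ × (Fin 2 → ℝ) × (Fin 3 → ℝ)) with hR
  have hmem : ∀ {q : MvPolynomial (Fin 3) ℝ}, (∀ i, q.degreeOf i ≤ d) →
      ((toFun q (Φ z), d1 (fun z => toFun q (Φ z)) z, jet2 (fun z => toFun q (Φ z)) z) :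
        ℝ × (Fin 2 → ℝ) × (Fin 3 → ℝ)) ∈ R := by
    intro q hq
    obtain ⟨p, hp⟩ := jets_mem_range_D012 hΦ hq z
    exact LinearMap.mem_range.2 ⟨p, hp⟩
  -- (i) constants: `(1, 0, 0) ∈ R`
  have h1 : (((1 : ℝ), (0 : Fin 2 → ℝ), (0 : Fin 3 → ℝ)) : ℝ × (Fin 2 → ℝ) × (Fin 3 → ℝ)) ∈ R := by
    have hq : ∀ i, (MvPolynomial.C (1 : ℝ) : MvPolynomial (Fin 3) ℝ).degreeOf i ≤ d := fun i => by
      rw [MvPolynomial.degreeOf_C]; exact Nat.zero_le _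
    have h := hmem hq
    have hv : toFun (MvPolynomial.C (1 : ℝ) : MvPolynomial (Fin 3) ℝ) (Φ z) = 1 := toFun_C 1 _
    have hfun : (fun z => toFun (MvPolynomial.C (1 : ℝ) : MvPolynomial (Fin 3) ℝ) (Φ z)) =
        fun _ => (1 : ℝ) := by funext z'; exact toFun_C 1 _
    have hd1 : d1 (fun _ : ℝ × 𝔼² => (1 : ℝ)) z = 0 := by
      funext i; simp [d1]
    have hd2 : jet2 (fun _ : ℝ × 𝔼² => (1 : ℝ)) z = 0 := by
      funext m; fin_cases m <;> simp [jet2, d2]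
    rw [hv, hfun, hd1, hd2] at h
    exact h
  -- the affine functions `nₖ = λₖ(Φ - P)` and their polynomials
  obtain ⟨Λ₀, hΛ₀d, hΛ₀⟩ := exists_poly_affine (lam 0) P
  obtain ⟨Λ₁, hΛ₁d, hΛ₁⟩ := exists_poly_affine (lam 1) P
  set Λ : Fin 2 → MvPolynomial (Fin 3) ℝ := ![Λ₀, Λ₁] with hΛ
  have hΛd : ∀ k i, (Λ k).degreeOf i ≤ 1 := fun k i => by
    fin_cases k
    · exact hΛ₀d i
    · exact hΛ₁d i
  have hΛf : ∀ k X, toFun (Λ k) X = lam k (X - P) := fun k X => by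
    fin_cases k
    · exact hΛ₀ X
    · exact hΛ₁ X
  -- jets of `nₖ ∘ Φ`
  have hn0 : ∀ k, lam k (Φ z - P) = 0 := fun k => by rw [hP, sub_self, map_zero]
  have hnd1 : ∀ k i, d1 (fun z => lam k (Φ z - P)) z i = if k = i then 1 else 0 := fun k i => by
    rw [d1_affine_comp (lam k) P hΦ1, hlam]
  have hns : ∀ k, ContDiff ℝ ∞ fun z => lam k (Φ z - P) := fun k => contDiff_affine_comp _ _ hΦ
  -- (ii) products: `(0, 0, jet2(nₖ nₗ)) ∈ R` with explicit second jets
  have hprod : ∀ k l, (((0 : ℝ), (0 : Fin 2 → ℝ),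
      (fun m : Fin 3 => d2 (fun z => lam k (Φ z - P) * lam l (Φ z - P)) z
        (![0, 0, 1] m) (![0, 1, 1] m))) : ℝ × (Fin 2 → ℝ) × (Fin 3 → ℝ)) ∈ R := by
    intro k l
    have hq : ∀ i, (Λ k * Λ l).degreeOf i ≤ d := fun i =>
      (MvPolynomial.degreeOf_mul_le i _ _).trans ((add_le_add (hΛd k i) (hΛd l i)).trans hd)
    have h := hmem hq
    have hfun : (fun z => toFun (Λ k * Λ l) (Φ z)) =
        fun z => lam k (Φ z - P) * lam l (Φ z - P) := by
      funext z'; rw [toFun_mul, hΛf, hΛf]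
    rw [hfun] at h
    have hv : lam k (Φ z - P) * lam l (Φ z - P) = 0 := by rw [hn0, zero_mul]
    have hd1' : d1 (fun z => lam k (Φ z - P) * lam l (Φ z - P)) z = 0 := by
      funext i
      rw [d1_mul ((hns k).differentiable (by simp)) ((hns l).differentiable (by simp)), hn0, hn0]
      simp
    have hjet : jet2 (fun z => lam k (Φ z - P) * lam l (Φ z - P)) z =
        fun m : Fin 3 => d2 (fun z => lam k (Φ z - P) * lam l (Φ z - P)) z
          (![0, 0, 1] m) (![0, 1, 1] m) := by
      funext m; fin_cases m <;> simp [jet2]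
    have hv' : toFun (Λ k * Λ l) (Φ z) = 0 := by rw [toFun_mul, hΛf, hΛf, hv]
    rw [hv', hd1', hjet] at h
    exact h
  have hd2val : ∀ k l i j, d2 (fun z => lam k (Φ z - P) * lam l (Φ z - P)) z i j =
      (if k = i then 1 else 0) * (if l = j then 1 else 0) +
        (if k = j then 1 else 0) * (if l = i then 1 else 0) := by
    intro k l i j
    rw [d2_mul ((hns k).of_le two_le_infty) ((hns l).of_le two_le_infty), hn0, hn0, hnd1, hnd1,
      hnd1, hnd1]
    ring
  -- the three coordinate vectors of the `jet2` factor
  have hv00 : (fun m : Fin 3 => d2 (fun z => lam 0 (Φ z - P) * lam 0 (Φ z - P)) z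
      (![0, 0, 1] m) (![0, 1, 1] m)) = fun m => if m = 0 then 2 else 0 := by
    funext m; fin_cases m <;> simp only [hd2val] <;> simp [one_add_one_eq_two]
  have hv01 : (fun m : Fin 3 => d2 (fun z => lam 0 (Φ z - P) * lam 1 (Φ z - P)) z
      (![0, 0, 1] m) (![0, 1, 1] m)) = fun m => if m = 1 then 1 else 0 := by
    funext m; fin_cases m <;> simp only [hd2val] <;> simp
  have hv11 : (fun m : Fin 3 => d2 (fun z => lam 1 (Φ z - P) * lam 1 (Φ z - P)) z
      (![0, 0, 1] m) (![0, 1, 1] m)) = fun m => if m = 2 then 2 else 0 := by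
    funext m; fin_cases m <;> simp only [hd2val] <;> simp [one_add_one_eq_two]
  have hE : ∀ m : Fin 3, (((0 : ℝ), (0 : Fin 2 → ℝ), (Pi.single m 1 : Fin 3 → ℝ)) :
      ℝ × (Fin 2 → ℝ) × (Fin 3 → ℝ)) ∈ R := by
    intro m
    fin_cases m
    · have h := R.smul_mem (1 / 2 : ℝ) (hprod 0 0)
      rw [hv00] at h
      have heq : (((0 : ℝ), (0 : Fin 2 → ℝ), (Pi.single (0 : Fin 3) 1 : Fin 3 → ℝ)) :
          ℝ × (Fin 2 → ℝ) × (Fin 3 → ℝ)) =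
          (1 / 2 : ℝ) • (((0 : ℝ), (0 : Fin 2 → ℝ), (fun m : Fin 3 => if m = 0 then (2 : ℝ) else 0)) :
            ℝ × (Fin 2 → ℝ) × (Fin 3 → ℝ)) := by
        refine Prod.ext (by simp) (Prod.ext (by simp) ?_)
        funext m; fin_cases m <;> simp
      simpa [heq] using h
    · have h := hprod 0 1
      rw [hv01] at h
      have heq : (((0 : ℝ), (0 : Fin 2 → ℝ), (Pi.single (1 : Fin 3) 1 : Fin 3 → ℝ)) :
          ℝ × (Fin 2 → ℝ) × (Fin 3 → ℝ)) =
          (((0 : ℝ), (0 : Fin 2 → ℝ), (fun m : Fin 3 => if m = 1 then (1 : ℝ) else 0)) :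
            ℝ × (Fin 2 → ℝ) × (Fin 3 → ℝ)) := by
        refine Prod.ext (by simp) (Prod.ext (by simp) ?_)
        funext m; fin_cases m <;> simp
      simpa [heq] using h
    · have h := R.smul_mem (1 / 2 : ℝ) (hprod 1 1)
      rw [hv11] at h
      have heq : (((0 : ℝ), (0 : Fin 2 → ℝ), (Pi.single (2 : Fin 3) 1 : Fin 3 → ℝ)) :
          ℝ × (Fin 2 → ℝ) × (Fin 3 → ℝ)) =
          (1 / 2 : ℝ) • (((0 : ℝ), (0 : Fin 2 → ℝ), (fun m : Fin 3 => if m = 2 then (2 : ℝ) else 0)) :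
            ℝ × (Fin 2 → ℝ) × (Fin 3 → ℝ)) := by
        refine Prod.ext (by simp) (Prod.ext (by simp) ?_)
        funext m; fin_cases m <;> simp
      simpa [heq] using h
  have hC : ∀ c : Fin 3 → ℝ, (((0 : ℝ), (0 : Fin 2 → ℝ), c) : ℝ × (Fin 2 → ℝ) × (Fin 3 → ℝ)) ∈ R := by
    intro c
    have : (((0 : ℝ), (0 : Fin 2 → ℝ), c) : ℝ × (Fin 2 → ℝ) × (Fin 3 → ℝ)) =
        c 0 • (((0 : ℝ), (0 : Fin 2 → ℝ), (Pi.single 0 1 : Fin 3 → ℝ)) : ℝ × (Fin 2 → ℝ) × (Fin 3 → ℝ)) +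
        c 1 • (((0 : ℝ), (0 : Fin 2 → ℝ), (Pi.single 1 1 : Fin 3 → ℝ)) : ℝ × (Fin 2 → ℝ) × (Fin 3 → ℝ)) +
        c 2 • (((0 : ℝ), (0 : Fin 2 → ℝ), (Pi.single 2 1 : Fin 3 → ℝ)) : ℝ × (Fin 2 → ℝ) × (Fin 3 → ℝ)) := by
      refine Prod.ext (by simp) (Prod.ext (by funext i; simp) ?_)
      funext m; fin_cases m <;> simp
    rw [this]
    exact R.add_mem (R.add_mem (R.smul_mem _ (hE 0)) (R.smul_mem _ (hE 1))) (R.smul_mem _ (hE 2))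
  -- (iii) first partials from `nᵢ`
  have hA : ∀ i : Fin 2, (((0 : ℝ), (Pi.single i 1 : Fin 2 → ℝ), (0 : Fin 3 → ℝ)) :
      ℝ × (Fin 2 → ℝ) × (Fin 3 → ℝ)) ∈ R := by
    intro i
    have hq : ∀ m, (Λ i).degreeOf m ≤ d := fun m => (hΛd i m).trans (le_trans (by norm_num) hd)
    have h := hmem hq
    have hfun : (fun z => toFun (Λ i) (Φ z)) = fun z => lam i (Φ z - P) := by
      funext z'; rw [hΛf]
    rw [hfun] at h
    have hv : lam i (Φ z - P) = 0 := hn0 i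
    have hd1' : d1 (fun z => lam i (Φ z - P)) z = Pi.single i 1 := by
      funext j
      rw [hnd1, Pi.single_apply]
      by_cases hij : i = j
      · subst hij; simp
      · simp [hij, Ne.symm hij]
    have hv' : toFun (Λ i) (Φ z) = 0 := by rw [hΛf, hv]
    rw [hv', hd1'] at h
    have h' := R.sub_mem h (hC (jet2 (fun z => lam i (Φ z - P)) z))
    simpa using h'
  -- (iv) everything
  intro y
  obtain ⟨v, a, c⟩ := y
  have ha : (((0 : ℝ), a, (0 : Fin 3 → ℝ)) : ℝ × (Fin 2 → ℝ) × (Fin 3 → ℝ)) =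
      a 0 • (((0 : ℝ), (Pi.single 0 1 : Fin 2 → ℝ), (0 : Fin 3 → ℝ)) : ℝ × (Fin 2 → ℝ) × (Fin 3 → ℝ)) +
      a 1 • (((0 : ℝ), (Pi.single 1 1 : Fin 2 → ℝ), (0 : Fin 3 → ℝ)) : ℝ × (Fin 2 → ℝ) × (Fin 3 → ℝ)) := by
    refine Prod.ext (by simp) (Prod.ext ?_ (by funext m; simp))
    funext i; fin_cases i <;> simp
  have hy : ((v, a, c) : ℝ × (Fin 2 → ℝ) × (Fin 3 → ℝ)) =
      v • (((1 : ℝ), (0 : Fin 2 → ℝ), (0 : Fin 3 → ℝ)) : ℝ × (Fin 2 → ℝ) × (Fin 3 → ℝ)) +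
        (((0 : ℝ), a, (0 : Fin 3 → ℝ)) : ℝ × (Fin 2 → ℝ) × (Fin 3 → ℝ)) +
        (((0 : ℝ), (0 : Fin 2 → ℝ), c) : ℝ × (Fin 2 → ℝ) × (Fin 3 → ℝ)) := by
    ext <;> simp
  have hyR : ((v, a, c) : ℝ × (Fin 2 → ℝ) × (Fin 3 → ℝ)) ∈ R := by
    rw [hy]
    refine R.add_mem (R.add_mem (R.smul_mem _ h1) ?_) (hC c)
    rw [ha]
    exact R.add_mem (R.smul_mem _ (hA 0)) (R.smul_mem _ (hA 1))
  obtain ⟨p, hp⟩ := LinearMap.mem_range.1 hyR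
  exact ⟨p, hp⟩

end SinglePoint

end CerfPath

end Literature.Topology.FourManifolds
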